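import Summits.BirchSwinnertonDyer.BirchSwinnertonDyer.Theorems.EisensteinPrimesBSDpOnCellCTelescopeK2PurityOfProp411OfCofree
import Summits.BirchSwinnertonDyer.BirchSwinnertonDyer.Theorems.SignedBaseChangeAnticyclotomicEisensteinDivisibilityGreenbergFullAtSqueeze
import Summits.BirchSwinnertonDyer.BirchSwinnertonDyer.Theorems.UniversalToricDescentThinCombNoPseudoNullOfPoitouTate
import Summits.BirchSwinnertonDyer.BirchSwinnertonDyer.Theorems.EisensteinPrimesPoitouTateShaNaturalAtTC
import Literature.NumberTheory.IwasawaTheory.Greenberg2006.GlobalEulerPoincareCorankOfTateTC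
import Literature.NumberTheory.GaloisCohomology.TateGlobalEulerCharacteristicTotallyComplex
import Literature.NumberTheory.GaloisCohomology.RestrictedRamificationPoitouTateThreeLeTotallyComplex
import Literature.NumberTheory.GaloisRepresentations.LocalEulerPoincareCharacteristicProofs
import Literature.NumberTheory.IwasawaTheory.Greenberg2006.CohomologyCofiniteGenerationDischarged
import Literature.NumberTheory.IwasawaTheory.Greenberg2006.LocalH2VanishingOfLOC1
import HarnessLib

/-!
# Crux 4 `BSDpOnCellC` (stmt-BirchSwinnertonDyer-19034), line «telescope», workfile `Lines/telescopeK2weight2.lean` v1.2,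
# sub-leaf W4⁰ (`K2Weight2.stub_bigPseudoNullPTorsion`), route G′ **FACT-FREE**: the W4⁰ conclusion for `X₂ = XBig κ ρ 𝔮 Σ₀`
# with NO named fact among the hypotheses (ideator seat `bsd-idea-12` gen 40, helper #2; `--as helper`; THEOREMS ONLY)

Notation: `B = IwasawaAlgebra₂ p = ℤ_p⟦X⟧⟦T⟧`; `A` a discrete `p`-primary `IwasawaAlgebra p = ℤ_p⟦X⟧`-module with a continuous
`Γ_K`-action `ρ`; `𝐃 = BigRepModule (IwasawaAlgebra p) p A` with `AnticyclotomicBigGaloisRep κ ρ`, `ρ_S` its descent to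
`G_{K,S}` (`TelescopeK2RepDescent.descendUnramified`); `𝓛 = specOfIndexSet S ρ_S (strictSet p 𝔮 Σ₀)` (STRICT at `𝔮`, RELAXED at
the other `w ∣ p` and on `Σ₀`, UNRAMIFIED elsewhere); `S_𝓛(K, 𝐃) ≃ selmerBig κ ρ 𝔮 Σ₀` (`selmerEquivOfKer`), `X₂` its dual;
`m = rank_{ℤ_p⟦X⟧} Hom(A, ℚ/ℤ)`.

WHAT CHANGES relative to `TelescopeK2PurityOfProp411{,OfCofree}`: there the Prop. 4.1.1 (c) step at the core `𝓛'` consumed the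
NAMED FACT `prop411_selmer_isAlmostDivisible`, hence LEO(𝐃) and LOC⁽²⁾ on `Σ`. Here that step is the TREE theorem
`selmer_isAlmostDivisible_caseC_of_prop321_of_isCotorsion_H_two'` (Prop. 4.1.1 (c), `K` totally complex, `H²(K_Σ/K, 𝐃)`
cotorsion, GRANTED [Gr5] Prop. 3.2.1 (c)), with `h321` the TREE theorem `prop321_caseC_of_poitouTateAt` fed with the TREE theorem
`forall_poitouTate_shaRestricted_tateDual_natural_at_of_isTotallyComplex`. So LEO and LOC⁽²⁾ are not consumed; `H²` cotorsion
and CRK(𝐃, 𝓛) are, and §2 delivers both by the corank squeeze: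
* §1 `isCotorsion_quotient`; `isCotorsion_of_smul_dual_eq_zero` (one dual killed by `s ≠ 0` ⇒ cotorsion); and
  `hasCorank_QGlobal_specOfIndexSet_strictSet`: **`corank Q_𝓛 = m`** when `corank H¹(K_𝔮, 𝐃) = m` and `H¹(K_w, 𝐃)` is cotorsion at
  the unramified-condition places (`Q_𝔮 = H¹(K_𝔮, 𝐃)`, `Q = 0` at `∞` and at the no-index places, a quotient of `H¹` elsewhere).
* §2 `isCotorsion_H2_and_crk_of_squeeze`: **`H²(K_Σ/K, 𝐃)` cotorsion ∧ CRK(𝐃, 𝓛) ∧ `corank H¹ = m` ∧ `corank H² = 0`** for `K`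
  with complex archimedean places and `r₂ = 1`, from (cof) (`𝐃` cofinitely generated of corank `m`, #1), (tor) one scalar `s ≠ 0`
  killing `X₂` (`corank S_𝓛 = 0`), `𝔮 ∈ S` above `p` of local degree one with `corank H⁰(K_𝔮, 𝐃) = 0` and LOC_𝔮⁽¹⁾ (`corank
  H¹(K_𝔮, 𝐃) = m`, `corank H⁰(K_Σ/K, 𝐃) = 0`), cotorsion of `H¹(K_w, 𝐃)` at the unramified-condition places; the squeeze is the
  tree's generic `SignedBaseChangeAcDivGreenbergSqueeze.hasCorank_H1_and_H2_zero_of_corank`; Greenberg 2006 Props. 4.1 / 4.2 / 3.2 /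
  §5 A enter as the TREE theorems `prop41_of_tate_of_poitouTate_three_le_of_isTotallyComplex`, `prop42_localEulerPoincareCorank_holds`,
  `prop32_cohomology_isCofinitelyGenerated_holds`, `sec5A_localH2_subsingleton_of_LOC1_holds` (as `…OfNamedFactsV18` feeds them).
  Variant `isCotorsion_localH1_of_h0_of_loc1`: the cotorsion input at `w ∤ p` from `corank H⁰(K_w, 𝐃) = 0` ∧ LOC_w⁽¹⁾.
* §3 `forall_isPseudoNull_exists_pow_smul_eq_zero_tc`: route G′ at Selmer level, totally-complex road, GRANTED (cof), `H²`
  cotorsion, CRK, LOC⁽¹⁾ at the finite no-index places of `S ∖ {𝔮}` (core `𝓛'` p762606, CRK(𝓛') p761529, tolerant transfer p756899).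
* §4 `forall_isPseudoNull_XBig_exists_pow_smul_eq_zero_factFree` — **THE FACT-FREE W4⁰ ENDPOINT** (§2 ∘ §3 at `X₂`). DISPLAYED ROWS:
  (cof) + `p`-primarity of `A`; (tor) `∃ s ≠ 0, s • X₂ = 0` (⟸ the stub's (reg₀)); `K`: archimedean places complex, `r₂ = 1`;
  `S` finite ⊇ `{w ∣ p} ∪ Σ₀`, `ramificationSubgroup K S ≤ ker`, `𝔮 ∈ S`, `p ∈ 𝔮`, `e·f(𝔮|p) = 1`, `𝔭 ∈ S`, `p ∈ 𝔭`, `𝔭 ≠ 𝔮`;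
  LOCAL rows for `𝐃`: LOC⁽¹⁾ at the no-index places of `S ∖ {𝔮}` and at `𝔮`, `corank_B H⁰(K_𝔮, 𝐃) = 0`, `H¹(K_w, 𝐃)` cotorsion
  at every `w ∈ S` with `w ∤ p`, `w ∉ Σ₀`.

HONEST FRAMING: helper theorems on stmt-19034 (`--as helper`); no `def`, no `instance`, no named fact introduced or consumed,
no `sorry`; closes no registered stub, no crux, no summit statement; BSD is proved for no curve. AI-typed, kernel-checked.

References: R. Greenberg, *On the structure of Selmer groups*, Springer PROMS 188 (2016), §1 p. 3, §2.2–2.3 pp. 6–7,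
Prop. 4.1.1 (c) p. 15, §4.3 p. 20 [Greenberg2016Selmer]; R. Greenberg, *On the structure of certain Galois cohomology groups*,
Doc. Math. Extra Vol. Coates (2006), Prop. 3.2 p. 358, Props. 4.1, 4.2 pp. 367–368, §5 A p. 373, Prop. 6.10 p. 385 [Greenberg2006];
R. Greenberg, *Surjectivity of the global-to-local map defining a Selmer group*, Kyoto J. Math. 50 (2010), Prop. 3.2.1 (c)
[Greenberg2010]; J. S. Milne, *Arithmetic Duality Theorems* (2nd ed. 2006), I Thm. 4.10 (a), I Thm. 5.1 [MilneADT2006];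
F. Castella, erratum to *On the p-adic variation of Heegner points* (2018), §2 [Castella2018Erratum].
-/

set_option linter.dupNamespace false
set_option autoImplicit false

noncomputable section

open Function
open Field IsDedekindDomain NumberField IsLocalRing
open Literature.NumberTheory.GaloisRepresentations Literature.NumberTheory.EllipticCurves
open Literature.NumberTheory.EllipticCurves.BigGaloisRep Literature.NumberTheory.IwasawaTheory
open Literature.NumberTheory.IwasawaTheory.Greenberg2016 Literature.NumberTheory.IwasawaTheory.Greenberg2006
open Summit.BirchSwinnertonDyer.BirchSwinnertonDyer.Theorems.GreenbergFullAtSelmer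
open Summit.BirchSwinnertonDyer.BirchSwinnertonDyer.Theorems.SignedBaseChangeAcDivGreenbergSqueeze
open scoped NumberField

universe u

namespace Summit.BirchSwinnertonDyer.BirchSwinnertonDyer.Theorems.TelescopeK2PurityFactFree

/-! ## §1 Generic atoms: quotients of cotorsion modules, cotorsion from one killed dual, `corank Q_𝓛 = m` for the K2 structure -/

section Generic

variable {Λ : Type u} [CommRing Λ] {M : Type u} [AddCommGroup M] [Module Λ M]

/-- **A quotient of a cotorsion module is cotorsion**: a Pontryagin dual of `M ⧸ N` injects `Λ`-linearly into one of `M`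
(`Hom(·, ℚ/ℤ)` of the surjection `M → M ⧸ N`), and a submodule of a torsion module is torsion. [cite: Greenberg2016Selmer, §1 p. 1 L30–32, p. 2 L17–35] -/
theorem isCotorsion_quotient (h : IsCotorsion Λ M) (N : Submodule Λ M) : IsCotorsion Λ (M ⧸ N) := by
  intro Y _ _ toDual hY y
  have hT : Module.IsTorsion Λ (CharacterModule M) := h _ _ (isDualPairing_characterModule Λ M)
  obtain ⟨a, ha⟩ := @hT (CharacterModule.dual N.mkQ (hY.linearEquiv (isDualPairing_characterModule Λ (M ⧸ N)) y))
  refine ⟨a, (hY.linearEquiv (isDualPairing_characterModule Λ (M ⧸ N))).injective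
    (CharacterModule.dual_injective_of_surjective N.mkQ (Submodule.mkQ_surjective N) ?_)⟩
  rw [Submonoid.smul_def, map_smul, map_smul, map_zero, map_zero, ← Submonoid.smul_def, ha]

/-- **Cotorsion from ONE Pontryagin dual killed by a non-zero scalar** (`Λ` a domain): every other dual is
`Λ`-isomorphic to it (`IsDualPairing.linearEquiv`). [cite: Greenberg2016Selmer, §1 p. 2 L17–35] -/
theorem isCotorsion_of_smul_dual_eq_zero [IsDomain Λ] {X : Type u} [AddCommGroup X] [Module Λ X]
    {toDual : X →+ (M →+ AddCircle (1 : ℚ))} (hX : IsDualPairing Λ M toDual) {s : Λ} (hs : s ≠ 0)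
    (h : ∀ x : X, s • x = 0) : IsCotorsion Λ M := by
  intro Y _ _ toDualY hY y
  refine ⟨⟨s, mem_nonZeroDivisors_of_ne_zero hs⟩, (hY.linearEquiv hX).injective ?_⟩
  rw [Submonoid.mk_smul, map_smul, map_zero, h]

variable {K : Type} [Field K] [NumberField K] {S : Set (HeightOneSpectrum (𝓞 K))}
  {Λ₀ : Type} [CommRing Λ₀] [TopologicalSpace Λ₀]
  {D : Type} [AddCommGroup D] [Module Λ₀ D] [TopologicalSpace D] [DiscreteTopology D] [ContinuousSMul Λ₀ D]
  {ρ : ContinuousRep (GaloisGroupUnramifiedOutside K S) Λ₀ D}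

/-- **`corank_Λ Q_𝓛(K, 𝐃) = m` for the K2 structure `𝓛 = specOfIndexSet S ρ (strictSet p 𝔮 Σ₀)`** when
`corank H¹(K_𝔮, 𝐃) = m` and `H¹(K_w, 𝐃)` is cotorsion at every unramified-condition place `w ∈ S` (`w ≠ 𝔮`, `w ∤ p`,
`w ∉ Σ₀`): `Q_𝓛 = ∏_{v ∈ Σ} H¹(K_v, 𝐃)/L_v` with `L_𝔮 = 0`, `L_v = H¹` at `∞` and at the no-index places, and `Q_w` a quotient
of the cotorsion `H¹(K_w, 𝐃)` elsewhere (`hasCorank_pi_of_isCotorsion`). The K2 twin of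
`SignedBaseChangeAcDivGreenbergSqueeze.hasCorank_QGlobal_fullAt_of_corank`. [cite: Greenberg2016Selmer, §1 p. 3 L19–25, §2.3 p. 7 L7–17]
[cite: Castella2018Erratum, §2] -/
theorem hasCorank_QGlobal_specOfIndexSet_strictSet [IsDomain Λ₀] (hS : S.Finite) (p : ℕ)
    {𝔮 : HeightOneSpectrum (𝓞 K)} (h𝔮S : 𝔮 ∈ S) (Sig : Set (HeightOneSpectrum (𝓞 K))) {m : ℕ}
    (h𝔮m : HasCorank Λ₀ ((localRep S ρ (Sum.inr 𝔮)).H 1) m)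
    (hcot : ∀ w ∈ S, w ≠ 𝔮 → ((p : ℕ) : 𝓞 K) ∉ w.asIdeal → w ∉ Sig →
      IsCotorsion Λ₀ ((localRep S ρ (Sum.inr w)).H 1)) :
    HasCorank Λ₀ (TelescopeK2SelmerDictionary.specOfIndexSet S ρ (strictSet p 𝔮 Sig)).QGlobal m := by
  classical
  haveI := finite_sigmaPlace (K := K) hS
  haveI : Fintype (SigmaPlace S) := Fintype.ofFinite _
  refine hasCorank_pi_of_isCotorsion
    (S := fun v : SigmaPlace S ↦ (TelescopeK2SelmerDictionary.specOfIndexSet S ρ (strictSet p 𝔮 Sig)).Q v.1)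
    ⟨Sum.inr 𝔮, (inSigma_inr_iff S 𝔮).mpr h𝔮S⟩ ?_ ?_
  · exact hasCorank_of_linearEquiv (Submodule.quotEquivOfEqBot _
      (TelescopeK2CoreSpecification.specOfIndexSet_strictSet_inr_self S ρ p 𝔮 Sig)).symm h𝔮m
  · rintro ⟨v, hv⟩ hv𝔮
    rcases v with w | w
    · haveI : Subsingleton ((TelescopeK2SelmerDictionary.specOfIndexSet S ρ (strictSet p 𝔮 Sig)).Q (Sum.inl w)) :=
        Submodule.Quotient.subsingleton_iff.mpr (TelescopeK2SelmerDictionary.specOfIndexSet_inl S ρ _ w)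
      exact isCotorsion_of_subsingleton
    · have hwS : w ∈ S := (inSigma_inr_iff S w).mp hv
      have hw𝔮 : w ≠ 𝔮 := by rintro rfl; exact hv𝔮 rfl
      by_cases hidx : ((p : ℕ) : 𝓞 K) ∈ w.asIdeal ∨ w ∈ Sig
      · haveI : Subsingleton ((TelescopeK2SelmerDictionary.specOfIndexSet S ρ (strictSet p 𝔮 Sig)).Q (Sum.inr w)) :=
          Submodule.Quotient.subsingleton_iff.mpr
            (TelescopeK2CoreSpecification.specOfIndexSet_strictSet_inr_of_noIndex S ρ p 𝔮 Sig hw𝔮 hidx)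
        exact isCotorsion_of_subsingleton
      · rw [not_or] at hidx
        exact isCotorsion_quotient (hcot w hwS hw𝔮 hidx.1 hidx.2) _

end Generic

/-! ## §2 The corank squeeze docked at the K2 objects: `H²(K_Σ/K, 𝐃)` cotorsion and CRK(𝐃, 𝓛), fact-free -/
section K2

variable {K : Type} [Field K] [NumberField K] (p : ℕ) [Fact p.Prime]
  {A : Type} [AddCommGroup A] [Module (IwasawaAlgebra p) A] [TopologicalSpace A] [DiscreteTopology A]
  [TopologicalSpace (IwasawaAlgebra p)] [TopologicalSpace (IwasawaAlgebra₂ p)]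
  [IsTopologicalRing (IwasawaAlgebra₂ p)]
  [ContinuousSMul (IwasawaAlgebra₂ p) (BigRepModule (IwasawaAlgebra p) p A)]

/-- **Cotorsion of `H¹(K_w, 𝐃)` at a finite `w ∤ p` from `corank_B H⁰(K_w, 𝐃) = 0` and LOC_w⁽¹⁾(`𝐃`)** (Greenberg 2006
Prop. 4.2 (b): `h⁰ − h¹ + h² = 0`, §5 A: `h² = 0` under LOC⁽¹⁾, Prop. 3.2: cofinite generation — all TREE theorems), for
`𝐃 = BigRepModule(A)` with (cof): the variant form of the cotorsion row of `isCotorsion_H2_and_crk_of_squeeze`.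
[cite: Greenberg2006, Prop. 4.2 (b) (p. 368 L9–22), §5 A (p. 373), Prop. 3.2 (p. 358)] -/
theorem isCotorsion_localH1_of_h0_of_loc1
    (κ : ZpExtension K p) (ρ : ContinuousRep (absoluteGaloisGroup K) (IwasawaAlgebra p) A)
    (hA : ∀ a : A, ∃ k : ℕ, p ^ k • a = 0) (hcof : IsCofree (IwasawaAlgebra p) A)
    (S : Set (HeightOneSpectrum (𝓞 K))) (hSf : S.Finite)
    (hSp : ∀ v : HeightOneSpectrum (𝓞 K), ((p : ℕ) : 𝓞 K) ∈ v.asIdeal → v ∈ S)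
    (hS : ramificationSubgroup K S ≤ (AnticyclotomicBigGaloisRep κ ρ).ker)
    {w : HeightOneSpectrum (𝓞 K)} (hwp : ((p : ℕ) : 𝓞 K) ∉ w.asIdeal)
    (h0w : HasCorank (IwasawaAlgebra₂ p) ((localRep S
      (TelescopeK2RepDescent.descendUnramified S (AnticyclotomicBigGaloisRep κ ρ) hS) (Sum.inr w)).H 0) 0)
    (hLOC1w : LOC1 S (TelescopeK2RepDescent.descendUnramified S (AnticyclotomicBigGaloisRep κ ρ) hS) (Sum.inr w)) :
    IsCotorsion (IwasawaAlgebra₂ p) ((localRep S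
      (TelescopeK2RepDescent.descendUnramified S (AnticyclotomicBigGaloisRep κ ρ) hS) (Sum.inr w)).H 1) := by
  have hΛ := nonempty_iwasawaAlgebraTwoVar_ringEquiv_mvPowerSeries p
  have hprim : ∀ d : BigRepModule (IwasawaAlgebra p) p A, ∃ n : ℕ, (p ^ n : ℤ) • d = 0 := fun d => by
    obtain ⟨k, hk⟩ := BigRepModule.exists_pow_nsmul_eq_zero d
    exact ⟨k, by rw [← Nat.cast_pow, natCast_zsmul]; exact hk⟩
  have hcf := TelescopeK2PurityOfProp411OfCofree.isCofinitelyGenerated_bigRepModule_of_isCofree p hA hcof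
  have hm := TelescopeK2PurityOfProp411OfCofree.hasCorank_bigRepModule_of_isCofree p hA hcof
  exact isCotorsion_localH1_of_prop42 _ LocalEulerPoincareCorank.prop42_localEulerPoincareCorank_holds hSf hSp hΛ hprim hcf
    hwp hm h0w
    (hasCorank_localH2_zero_of_sec5A _ sec5A_localH2_subsingleton_of_LOC1_holds hSf hSp hΛ hprim hcf hLOC1w)
    (prop32_cohomology_isCofinitelyGenerated_holds.local hSf hSp hΛ _ hprim hcf (Sum.inr w) 1)

/-- **`H²(K_Σ/K, 𝐃)` is `B`-cotorsion ∧ CRK(𝐃, 𝓛) ∧ `corank_B H¹(K_Σ/K, 𝐃) = m` ∧ `corank_B H²(K_Σ/K, 𝐃) = 0`, BY THE CORANK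
SQUEEZE, fact-free** (`K` with complex archimedean places, `r₂ = 1`; `𝐃 = BigRepModule(A)` with (cof), corank `m`; `𝔮 ∈ S`
above `p` of local degree one; (tor) `s ≠ 0` killing `X₂`, so `corank S_𝓛 = 0` along `S_𝓛 ≃ Sel^{Σ₀}_𝔮`; `corank H⁰(K_𝔮, 𝐃) = 0`
and LOC_𝔮⁽¹⁾, so `corank H¹(K_𝔮, 𝐃) = m` and `corank H⁰(K_Σ/K, 𝐃) = 0`; cotorsion at the unramified-condition places, so
`corank Q_𝓛 = m`). Prop. 4.1: `−h¹ + h² = −m`; [Gr5] §2.3 (2): `h¹ ≤ 0 + m`; hence `h¹ = m`, `h² = 0`, CRK, and `H²` (Prop. 3.2)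
is cotorsion. [cite: Greenberg2006, Prop. 4.1 (p. 367 L40 – p. 368 L1), Prop. 4.2 (p. 368 L9–22), Prop. 3.2 (p. 358), §5 A (p. 373)]
[cite: Greenberg2016Selmer, §2.2 p. 6, §2.3 p. 7 L1–17] [cite: Castella2018Erratum, §2] -/
theorem isCotorsion_H2_and_crk_of_squeeze
    (κ : ZpExtension K p) (ρ : ContinuousRep (absoluteGaloisGroup K) (IwasawaAlgebra p) A)
    (hA : ∀ a : A, ∃ k : ℕ, p ^ k • a = 0) (hcof : IsCofree (IwasawaAlgebra p) A)
    (S : Set (HeightOneSpectrum (𝓞 K))) (hSf : S.Finite)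
    (hSp : ∀ v : HeightOneSpectrum (𝓞 K), ((p : ℕ) : 𝓞 K) ∈ v.asIdeal → v ∈ S)
    (hS : ramificationSubgroup K S ≤ (AnticyclotomicBigGaloisRep κ ρ).ker)
    (𝔮 : HeightOneSpectrum (𝓞 K)) (h𝔮S : 𝔮 ∈ S) (h𝔮p : ((p : ℕ) : 𝓞 K) ∈ 𝔮.asIdeal)
    (h𝔮deg : 𝔮.asIdeal.ramificationIdx ℤ * 𝔮.asIdeal.inertiaDeg ℤ = 1)
    (Sig : Set (HeightOneSpectrum (𝓞 K)))
    (hSig : ∀ w : HeightOneSpectrum (𝓞 K), w ∉ S → w ∉ Sig ∧ ((p : ℕ) : 𝓞 K) ∉ w.asIdeal)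
    (hTC : ∀ v : InfinitePlace K, v.IsComplex) (hr₂ : InfinitePlace.nrComplexPlaces K = 1)
    (h0𝔮 : HasCorank (IwasawaAlgebra₂ p) ((localRep S
      (TelescopeK2RepDescent.descendUnramified S (AnticyclotomicBigGaloisRep κ ρ) hS) (Sum.inr 𝔮)).H 0) 0)
    (hLOC1𝔮 : LOC1 S (TelescopeK2RepDescent.descendUnramified S (AnticyclotomicBigGaloisRep κ ρ) hS) (Sum.inr 𝔮))
    (hcot : ∀ w ∈ S, w ≠ 𝔮 → ((p : ℕ) : 𝓞 K) ∉ w.asIdeal → w ∉ Sig →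
      IsCotorsion (IwasawaAlgebra₂ p) ((localRep S
        (TelescopeK2RepDescent.descendUnramified S (AnticyclotomicBigGaloisRep κ ρ) hS) (Sum.inr w)).H 1))
    {s : IwasawaAlgebra₂ p} (hs : s ≠ 0) (hsX : ∀ x : XBig κ ρ 𝔮 Sig, s • x = 0) :
    IsCotorsion (IwasawaAlgebra₂ p)
        ((TelescopeK2RepDescent.descendUnramified S (AnticyclotomicBigGaloisRep κ ρ) hS).H 2) ∧
      (TelescopeK2SelmerDictionary.specOfIndexSet S
        (TelescopeK2RepDescent.descendUnramified S (AnticyclotomicBigGaloisRep κ ρ) hS) (strictSet p 𝔮 Sig)).CRK ∧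
      HasCorank (IwasawaAlgebra₂ p)
        ((TelescopeK2RepDescent.descendUnramified S (AnticyclotomicBigGaloisRep κ ρ) hS).H 1)
        (Module.finrank (IwasawaAlgebra p) (CharacterModule A)) ∧
      HasCorank (IwasawaAlgebra₂ p)
        ((TelescopeK2RepDescent.descendUnramified S (AnticyclotomicBigGaloisRep κ ρ) hS).H 2) 0 := by
  -- Greenberg 2006 Props. 4.1 / 4.2 / 3.2 / §5 A: TREE theorems
  have h41 : prop41_globalEulerPoincareCorank :=
    prop41_of_tate_of_poitouTate_three_le_of_isTotallyComplex
      Literature.NumberTheory.GaloisCohomology.forall_tateGlobalEulerPoincareCharacteristic_of_isTotallyComplex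
      Literature.NumberTheory.GaloisCohomology.forall_poitouTate_restricted_three_le_of_isTotallyComplex
  have h42 : prop42_localEulerPoincareCorank := LocalEulerPoincareCorank.prop42_localEulerPoincareCorank_holds
  have h32 : prop32_cohomology_isCofinitelyGenerated := prop32_cohomology_isCofinitelyGenerated_holds
  have h5A : sec5A_localH2_subsingleton_of_LOC1 := sec5A_localH2_subsingleton_of_LOC1_holds
  -- the arena data of `𝐃` over `B`
  have hΛ := nonempty_iwasawaAlgebraTwoVar_ringEquiv_mvPowerSeries p
  have hprim : ∀ d : BigRepModule (IwasawaAlgebra p) p A, ∃ n : ℕ, (p ^ n : ℤ) • d = 0 := fun d => by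
    obtain ⟨k, hk⟩ := BigRepModule.exists_pow_nsmul_eq_zero d
    exact ⟨k, by rw [← Nat.cast_pow, natCast_zsmul]; exact hk⟩
  have hcf := TelescopeK2PurityOfProp411OfCofree.isCofinitelyGenerated_bigRepModule_of_isCofree p hA hcof
  have hm := TelescopeK2PurityOfProp411OfCofree.hasCorank_bigRepModule_of_isCofree p hA hcof
  have hcfg : ∀ (v : Place K) (i : ℕ), IsCofinitelyGenerated (IwasawaAlgebra₂ p)
      ((localRep S (TelescopeK2RepDescent.descendUnramified S (AnticyclotomicBigGaloisRep κ ρ) hS) v).H i) :=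
    fun v i => h32.local hSf hSp hΛ _ hprim hcf v i
  -- local coranks at `𝔮`, global `h⁰ = 0`
  have h0 : HasCorank (IwasawaAlgebra₂ p)
      ((TelescopeK2RepDescent.descendUnramified S (AnticyclotomicBigGaloisRep κ ρ) hS).H 0) 0 :=
    hasCorank_H0_zero_of_local _ (Sum.inr 𝔮) (hcfg _ 0) h0𝔮
  have h2𝔮 : HasCorank (IwasawaAlgebra₂ p) ((localRep S
      (TelescopeK2RepDescent.descendUnramified S (AnticyclotomicBigGaloisRep κ ρ) hS) (Sum.inr 𝔮)).H 2) 0 :=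
    hasCorank_localH2_zero_of_sec5A _ h5A hSf hSp hΛ hprim hcf hLOC1𝔮
  have h𝔮m : HasCorank (IwasawaAlgebra₂ p) ((localRep S
      (TelescopeK2RepDescent.descendUnramified S (AnticyclotomicBigGaloisRep κ ρ) hS) (Sum.inr 𝔮)).H 1)
      (Module.finrank (IwasawaAlgebra p) (CharacterModule A)) :=
    hasCorank_localH1_of_prop42_degree_one _ h42 hSf hSp hΛ hprim hcf h𝔮p h𝔮deg hm h0𝔮 h2𝔮
  -- `corank S_𝓛 = 0` (one dual, `X₂`, is killed by `s ≠ 0`), `S_𝓛` cofinitely generated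
  obtain ⟨hL, hoff⟩ := TelescopeK2SelmerDictionary.strictSet_hyps S p 𝔮 Sig h𝔮S hSig
  have hSelcot : IsCotorsion (IwasawaAlgebra₂ p) ↥(TelescopeK2SelmerDictionary.specOfIndexSet S
      (TelescopeK2RepDescent.descendUnramified S (AnticyclotomicBigGaloisRep κ ρ) hS) (strictSet p 𝔮 Sig)).selmer :=
    isCotorsion_of_linearEquiv
      (TelescopeK2SelmerDictionary.selmerEquivOfKer S (AnticyclotomicBigGaloisRep κ ρ) hS (strictSet p 𝔮 Sig) hL hoff :
        _ ≃ₗ[IwasawaAlgebra₂ p] ↥(selmerBig κ ρ 𝔮 Sig))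
      (isCotorsion_of_smul_dual_eq_zero (isDualPairing_characterModule (IwasawaAlgebra₂ p) ↥(selmerBig κ ρ 𝔮 Sig)) hs hsX)
  have hSel := hasCorank_zero_of_isCotorsion' hSelcot
  have hSelfg := (h32.global hSf hSp hΛ _ hprim hcf 1).submodule
    (TelescopeK2SelmerDictionary.specOfIndexSet S
      (TelescopeK2RepDescent.descendUnramified S (AnticyclotomicBigGaloisRep κ ρ) hS) (strictSet p 𝔮 Sig)).selmer
  -- `corank Q_𝓛 = m`, `Q_𝓛` cofinitely generated
  have hQ := hasCorank_QGlobal_specOfIndexSet_strictSet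
    (ρ := TelescopeK2RepDescent.descendUnramified S (AnticyclotomicBigGaloisRep κ ρ) hS) hSf p h𝔮S Sig h𝔮m hcot
  have hQfg := SurLambda.isCofinitelyGenerated_QGlobal
    (TelescopeK2RepDescent.descendUnramified S (AnticyclotomicBigGaloisRep κ ρ) hS) hSf (Classical.choice hΛ) hcf
    (TelescopeK2SelmerDictionary.specOfIndexSet S
      (TelescopeK2RepDescent.descendUnramified S (AnticyclotomicBigGaloisRep κ ρ) hS) (strictSet p 𝔮 Sig))
  -- the squeeze
  obtain ⟨hH1, hH2⟩ := hasCorank_H1_and_H2_zero_of_corank _ h41 hSf hSp hTC hr₂ hΛ hprim hcf hm h0 _ hSel hSelfg hQ hQfg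
  exact ⟨isCotorsion_of_isCofinitelyGenerated_of_hasCorank_zero (h32.global hSf hSp hΛ _ hprim hcf 2) hH2,
    CRK_of_hasCorank _ (s₀ := 0) (q₀ := Module.finrank (IwasawaAlgebra p) (CharacterModule A)) (by simpa using hH1) hSel hQ,
    hH1, hH2⟩

/-! ## §3 Route G′ at Selmer level on the totally-complex road: Prop. 4.1.1 (c) at the core from tree theorems -/
/-- **Route G′, Selmer level, FACT-FREE.** GRANTED (cof) with `A` `p`-primary, `H²(K_Σ/K, 𝐃)` `B`-cotorsion, CRK(𝐃, 𝓛),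
LOC⁽¹⁾ at the finite no-index places of `S ∖ {𝔮}` (one of them `𝔭 ∣ p`, `𝔭 ≠ 𝔮`) and `K` totally complex, every pseudo-null
`B`-submodule of every Pontryagin dual `X` of `S_𝓛(K, 𝐃)` is killed by a power of `p`. Proof: the core `𝓛'` of the K2
structure (`exists_core_specification_strictSet`: `𝓛' ≤ 𝓛`, `p^a 𝓛 ⊆ 𝓛'`, `𝓛'` almost divisible, `𝓛' = 𝓛 = H¹` at the no-index
places) has CRK (`crk_of_core_pow`) and `Q_{𝓛'}(K_𝔭) = 0` coreflexive; Prop. 4.1.1 (c) at `η = 𝔭` in its totally-complex tree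
form `selmer_isAlmostDivisible_caseC_of_prop321_of_isCotorsion_H_two'` — [Gr5] Prop. 3.2.1 (c) supplied by
`prop321_caseC_of_poitouTateAt` ∘ `forall_poitouTate_shaRestricted_tateDual_natural_at_of_isTotallyComplex` — makes `S_{𝓛'}`
almost divisible; the tolerant transfer `forall_isPseudoNull_exists_pow_smul_eq_zero_selmer_of_core` concludes.
[cite: Greenberg2016Selmer, Prop. 4.1.1 (c) p. 15, §4.2 p. 19 L25–31, §4.3 p. 20 L19–30] [cite: Greenberg2006, Prop. 6.10 (p. 385)]
[cite: Greenberg2010, Prop. 3.2.1 (c) (p. 15)] [cite: MilneADT2006, I Thm. 4.10 (a) (p. 57)] -/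
theorem forall_isPseudoNull_exists_pow_smul_eq_zero_tc
    (κ : ZpExtension K p) (ρ : ContinuousRep (absoluteGaloisGroup K) (IwasawaAlgebra p) A)
    (hA : ∀ a : A, ∃ k : ℕ, p ^ k • a = 0) (hcof : IsCofree (IwasawaAlgebra p) A)
    (S : Set (HeightOneSpectrum (𝓞 K))) (hSf : S.Finite)
    (hSp : ∀ v : HeightOneSpectrum (𝓞 K), ((p : ℕ) : 𝓞 K) ∈ v.asIdeal → v ∈ S)
    (hS : ramificationSubgroup K S ≤ (AnticyclotomicBigGaloisRep κ ρ).ker)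
    (𝔮 : HeightOneSpectrum (𝓞 K)) (Sig : Set (HeightOneSpectrum (𝓞 K)))
    (hTC : ∀ v : InfinitePlace K, v.IsComplex)
    (hH2 : IsCotorsion (IwasawaAlgebra₂ p)
      ((TelescopeK2RepDescent.descendUnramified S (AnticyclotomicBigGaloisRep κ ρ) hS).H 2))
    (𝔭 : HeightOneSpectrum (𝓞 K)) (h𝔭S : 𝔭 ∈ S) (h𝔭p : ((p : ℕ) : 𝓞 K) ∈ 𝔭.asIdeal) (h𝔭q : 𝔭 ≠ 𝔮)
    (hLOC1 : ∀ w ∈ S, w ≠ 𝔮 → (((p : ℕ) : 𝓞 K) ∈ w.asIdeal ∨ w ∈ Sig) →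
      LOC1 S (TelescopeK2RepDescent.descendUnramified S (AnticyclotomicBigGaloisRep κ ρ) hS) (Sum.inr w))
    (hCRK : (TelescopeK2SelmerDictionary.specOfIndexSet S
      (TelescopeK2RepDescent.descendUnramified S (AnticyclotomicBigGaloisRep κ ρ) hS) (strictSet p 𝔮 Sig)).CRK)
    {X : Type} [AddCommGroup X] [Module (IwasawaAlgebra₂ p) X]
    {toDual : X →+ (↥(TelescopeK2SelmerDictionary.specOfIndexSet S
      (TelescopeK2RepDescent.descendUnramified S (AnticyclotomicBigGaloisRep κ ρ) hS) (strictSet p 𝔮 Sig)).selmer →+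
        AddCircle (1 : ℚ))}
    (hX : IsDualPairing (IwasawaAlgebra₂ p) ↥(TelescopeK2SelmerDictionary.specOfIndexSet S
      (TelescopeK2RepDescent.descendUnramified S (AnticyclotomicBigGaloisRep κ ρ) hS) (strictSet p 𝔮 Sig)).selmer toDual) :
    ∀ P : Submodule (IwasawaAlgebra₂ p) X, Module.IsPseudoNull (IwasawaAlgebra₂ p) ↥P →
      ∃ n : ℕ, ∀ x ∈ P, (((p : ℕ) : IwasawaAlgebra₂ p) ^ n) • x = 0 := by
  haveI : IsTotallyComplex K := ⟨hTC⟩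
  have hp0 : ((p : ℕ) : IwasawaAlgebra₂ p) ≠ 0 := fun h => by
    have h' := congrArg (fun f : IwasawaAlgebra₂ p => PowerSeries.constantCoeff (PowerSeries.constantCoeff f)) h
    simp only [map_natCast, map_zero, Nat.cast_eq_zero] at h'
    exact (Fact.out : p.Prime).ne_zero h'
  have hprim : ∀ d : BigRepModule (IwasawaAlgebra p) p A, ∃ n : ℕ, (p ^ n : ℤ) • d = 0 := fun d => by
    obtain ⟨k, hk⟩ := BigRepModule.exists_pow_nsmul_eq_zero d
    exact ⟨k, by rw [← Nat.cast_pow, natCast_zsmul]; exact hk⟩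
  have hΛ := nonempty_iwasawaAlgebraTwoVar_ringEquiv_mvPowerSeries p
  have hT := TelescopeK2PurityOfProp411OfCofree.isCofree_bigRepModule_of_isCofree p hA hcof
  have hRFX := TelescopeK2PurityOfProp411OfCofree.rfx_bigRepModule_of_isCofree p hA hcof
  have hD := TelescopeK2PurityOfProp411OfCofree.isCofinitelyGenerated_bigRepModule_of_isCofree p hA hcof
  have hLOC1𝔭 : LOC1 S (TelescopeK2RepDescent.descendUnramified S (AnticyclotomicBigGaloisRep κ ρ) hS) (Sum.inr 𝔭) :=
    hLOC1 𝔭 h𝔭S h𝔭q (Or.inl h𝔭p)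
  -- the core `𝓛'` of the K2 structure (almost divisible, `p^a 𝓛 ⊆ 𝓛' ⊆ 𝓛`, no condition at the no-index places)
  have harch : ∀ v : InfinitePlace K, Subsingleton ((localRep S
      (TelescopeK2RepDescent.descendUnramified S (AnticyclotomicBigGaloisRep κ ρ) hS) (Sum.inl v)).H 1) := fun v =>
    subsingleton_localH1_inl_of_isComplex S _ (hTC v)
  have hfin : ∀ w ∈ S, w ≠ 𝔮 → (((p : ℕ) : 𝓞 K) ∈ w.asIdeal ∨ w ∈ Sig) →
      IsAlmostDivisible (IwasawaAlgebra₂ p) ↥(⊤ : Submodule (IwasawaAlgebra₂ p) ((localRep S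
        (TelescopeK2RepDescent.descendUnramified S (AnticyclotomicBigGaloisRep κ ρ) hS) (Sum.inr w)).H 1)) :=
    fun w hwS hwq hw =>
      (isAlmostDivisible_localRep_H_one S
          (TelescopeK2RepDescent.descendUnramified S (AnticyclotomicBigGaloisRep κ ρ) hS) hSf hSp
          (Classical.choice hΛ) hprim hD hRFX (hLOC1 w hwS hwq hw)).of_surjective
        (Submodule.topEquiv :
            ↥(⊤ : Submodule (IwasawaAlgebra₂ p) ((localRep S
              (TelescopeK2RepDescent.descendUnramified S (AnticyclotomicBigGaloisRep κ ρ) hS) (Sum.inr w)).H 1)) ≃ₗ[_]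
              _).symm.toLinearMap
        Submodule.topEquiv.symm.surjective
  obtain ⟨L', a, hle, hr, hshape, hoff, hL'⟩ :=
    TelescopeK2CoreSpecification.exists_core_specification_strictSet p κ ρ hD S hSf hS 𝔮 Sig hfin harch
  have hCRK' : L'.CRK := TelescopeK2CoreCRKTransfer.crk_of_core_pow hle hp0 a hr hCRK
  have htop : L' (Sum.inr 𝔭) = ⊤ :=
    (hoff 𝔭 (Or.inl h𝔭p)).trans
      (TelescopeK2CoreSpecification.specOfIndexSet_strictSet_inr_of_noIndex S _ p 𝔮 Sig h𝔭q (Or.inl h𝔭p))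
  have hcorefl : IsCoreflexive (IwasawaAlgebra₂ p) (L'.Q (Sum.inr 𝔭)) := by
    haveI : Subsingleton (L'.Q (Sum.inr 𝔭)) := Submodule.Quotient.subsingleton_iff.mpr htop
    exact isCoreflexive_of_subsingleton
  -- [Gr5] Prop. 3.2.1 (c) at the totally complex `K`: a TREE theorem (Poitou–Tate at `S`)
  have h321 := UniversalToricDescentThinComb.NoPseudoNullOfPoitouTate.prop321_caseC_of_poitouTateAt (p := p) hSf hSp
    (PoitouTateShaNaturalAtTC.forall_poitouTate_shaRestricted_tateDual_natural_at_of_isTotallyComplex K S hSf)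
  -- Prop. 4.1.1 (c) at `η = 𝔭` for the core, totally-complex road
  have hS' : IsAlmostDivisible (IwasawaAlgebra₂ p) ↥L'.selmer :=
    selmer_isAlmostDivisible_caseC_of_prop321_of_isCotorsion_H_two' S
      (TelescopeK2RepDescent.descendUnramified S (AnticyclotomicBigGaloisRep κ ρ) hS) h321 hSf hSp hΛ
      (R := IwasawaAlgebra₂ p) (Module.Finite.self (IwasawaAlgebra₂ p)) hT hprim L' hRFX hH2 h𝔭S hLOC1𝔭 hL' hCRK' hcorefl
  exact TelescopeK2PurityTolerantOfCore.forall_isPseudoNull_exists_pow_smul_eq_zero_selmer_of_core hle _ a hr hS' hX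

/-! ## §4 THE FACT-FREE W4⁰ ENDPOINT at `X₂ = XBig κ ρ 𝔮 Σ₀` -/
/-- **W4⁰ shape, fact-free: every pseudo-null `B`-submodule of `X₂ = XBig κ ρ 𝔮 Σ₀` is killed by a power of `p`**, GRANTED ONLY:
(cof) `A` cofree over `ℤ_p⟦X⟧` and `p`-primary; (tor) a scalar `s ≠ 0` of `B` killing `X₂`; `K` with all archimedean places
complex and `r₂ = 1`; `S` finite ⊇ `{w ∣ p} ∪ Σ₀` with `ramificationSubgroup K S ≤ ker`, `𝔮 ∈ S` above `p` of local degree one,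
`𝔭 ∈ S` above `p`, `𝔭 ≠ 𝔮`; and the LOCAL Galois rows for `𝐃`: LOC⁽¹⁾ at the finite no-index places of `S ∖ {𝔮}` and at `𝔮`,
`corank_B H⁰(K_𝔮, 𝐃) = 0`, `H¹(K_w, 𝐃)` `B`-cotorsion at every `w ∈ S` with `w ∤ p`, `w ∉ Σ₀`. NO named fact is consumed.
Proof: §2 (`H²` cotorsion, CRK) ∘ §3, docked at `X₂` along the dictionary `S_𝓛 ≃ Sel^{Σ₀}_𝔮` (`selmerEquivOfKer`).
[cite: Greenberg2016Selmer, Prop. 4.1.1 (c) p. 15, §2.3 p. 7 L1–17, §1 p. 3 L19–34] [cite: Greenberg2006, Props. 4.1, 4.2 (pp. 367–368), §5 A (p. 373), Prop. 6.10 (p. 385)]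
[cite: Greenberg2010, Prop. 3.2.1 (c) (p. 15)] [cite: Castella2018Erratum, §2] -/
theorem forall_isPseudoNull_XBig_exists_pow_smul_eq_zero_factFree
    (κ : ZpExtension K p) (ρ : ContinuousRep (absoluteGaloisGroup K) (IwasawaAlgebra p) A)
    (hA : ∀ a : A, ∃ k : ℕ, p ^ k • a = 0) (hcof : IsCofree (IwasawaAlgebra p) A)
    (S : Set (HeightOneSpectrum (𝓞 K))) (hSf : S.Finite)
    (hSp : ∀ v : HeightOneSpectrum (𝓞 K), ((p : ℕ) : 𝓞 K) ∈ v.asIdeal → v ∈ S)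
    (hS : ramificationSubgroup K S ≤ (AnticyclotomicBigGaloisRep κ ρ).ker)
    (𝔮 : HeightOneSpectrum (𝓞 K)) (h𝔮S : 𝔮 ∈ S) (h𝔮p : ((p : ℕ) : 𝓞 K) ∈ 𝔮.asIdeal)
    (h𝔮deg : 𝔮.asIdeal.ramificationIdx ℤ * 𝔮.asIdeal.inertiaDeg ℤ = 1)
    (Sig : Set (HeightOneSpectrum (𝓞 K)))
    (hSig : ∀ w : HeightOneSpectrum (𝓞 K), w ∉ S → w ∉ Sig ∧ ((p : ℕ) : 𝓞 K) ∉ w.asIdeal)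
    (hTC : ∀ v : InfinitePlace K, v.IsComplex) (hr₂ : InfinitePlace.nrComplexPlaces K = 1)
    (𝔭 : HeightOneSpectrum (𝓞 K)) (h𝔭S : 𝔭 ∈ S) (h𝔭p : ((p : ℕ) : 𝓞 K) ∈ 𝔭.asIdeal) (h𝔭q : 𝔭 ≠ 𝔮)
    (hLOC1 : ∀ w ∈ S, w ≠ 𝔮 → (((p : ℕ) : 𝓞 K) ∈ w.asIdeal ∨ w ∈ Sig) →
      LOC1 S (TelescopeK2RepDescent.descendUnramified S (AnticyclotomicBigGaloisRep κ ρ) hS) (Sum.inr w))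
    (hLOC1𝔮 : LOC1 S (TelescopeK2RepDescent.descendUnramified S (AnticyclotomicBigGaloisRep κ ρ) hS) (Sum.inr 𝔮))
    (h0𝔮 : HasCorank (IwasawaAlgebra₂ p) ((localRep S
      (TelescopeK2RepDescent.descendUnramified S (AnticyclotomicBigGaloisRep κ ρ) hS) (Sum.inr 𝔮)).H 0) 0)
    (hcot : ∀ w ∈ S, w ≠ 𝔮 → ((p : ℕ) : 𝓞 K) ∉ w.asIdeal → w ∉ Sig →
      IsCotorsion (IwasawaAlgebra₂ p) ((localRep S
        (TelescopeK2RepDescent.descendUnramified S (AnticyclotomicBigGaloisRep κ ρ) hS) (Sum.inr w)).H 1))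
    {s : IwasawaAlgebra₂ p} (hs : s ≠ 0) (hsX : ∀ x : XBig κ ρ 𝔮 Sig, s • x = 0) :
    ∀ P : Submodule (IwasawaAlgebra₂ p) (XBig κ ρ 𝔮 Sig), Module.IsPseudoNull (IwasawaAlgebra₂ p) ↥P →
      ∃ n : ℕ, ∀ x ∈ P, (((p : ℕ) : IwasawaAlgebra₂ p) ^ n) • x = 0 := by
  obtain ⟨hH2, hCRK, -, -⟩ := isCotorsion_H2_and_crk_of_squeeze p κ ρ hA hcof S hSf hSp hS 𝔮 h𝔮S h𝔮p h𝔮deg Sig hSig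
    hTC hr₂ h0𝔮 hLOC1𝔮 hcot hs hsX
  obtain ⟨hL, hoff⟩ := TelescopeK2SelmerDictionary.strictSet_hyps S p 𝔮 Sig h𝔮S hSig
  have hX := isDualPairing_precomp_linearEquiv
    (TelescopeK2SelmerDictionary.selmerEquivOfKer S (AnticyclotomicBigGaloisRep κ ρ) hS (strictSet p 𝔮 Sig) hL hoff :
      _ ≃ₗ[IwasawaAlgebra₂ p] ↥(selmerBig κ ρ 𝔮 Sig))
    (isDualPairing_characterModule (IwasawaAlgebra₂ p) ↥(selmerBig κ ρ 𝔮 Sig))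
  exact forall_isPseudoNull_exists_pow_smul_eq_zero_tc p κ ρ hA hcof S hSf hSp hS 𝔮 Sig hTC hH2 𝔭 h𝔭S h𝔭p h𝔭q hLOC1
    hCRK hX

end K2

end Summit.BirchSwinnertonDyer.BirchSwinnertonDyer.Theorems.TelescopeK2PurityFactFree

end
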